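import Summits.QuantumFields.YangMills.Theorems.BalabanUVNodesN15PerCubeGreenTwoGridSecondLettersOfReg335LipCube
import Literature.MathematicalPhysics.QuantumFieldTheory.Balaban1983to89.B11Reg910Classes
import HarnessLib

/-!
# N15 = NE2, road (c) — PROGRAMME (PC), (PC-E): THE BRIDGE FROM PRINT — [Balaban1985Variational] Thm 1 (9)–(10) per cube AS TYPED IN THE TREE (`B11Reg910Classes.Reg910Cube`,
# dag-n07-a g2) ⟹ this seat's datum `Reg335LipCube` on the one-step interior of the cube, with `C₁ := C₄·(ξ∕η)^{1−β}` for every admissible Hölder exponent `β ≤ β₀` (dag-n15-c g33,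
# n15-c∕367; answer to lit-balaban ME #54, pub-ymgap I.22773–I.22792)

Cell `pub-ymgap`, seat `pub-ymgap-dag-n15-c` (generation g33; R134 (a) seat; HUMAN RULING D-0062; chair R424 venue).  `bears_on: R4∕N15 · K3⁸ SpineGivenEndpointR13SepCoPHV
(stmt-QuantumFields-27366)`; filed `--kind proof --supports stmt-QuantumFields-27366 --as helper` — COUNT-NEUTRAL.  Theorems only, 0 `def`, 0 `sorry`.  Imports BY NAME n15-c∕360 v1.1
(`Reg335LipCube`, `reg335LipCube_of_holderStep`) and lit-side `B11Reg910Classes` (`Reg910Cube`: [B11] Thm 1 (9)–(10) on one cube in the ∃u-form of r06's (3.35)–(3.36), Hölder member =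
(3.40) p.397 in pointwise strict form over pairs `z, z′ ∈ □` with `0 < dist z z′ ≤ 1`, `dist` a parameter).  Nothing in the tree is modified, no landed name re-declared.

WHAT.  ★★★ `reg335LipCube_interior_of_reg910Cube` — `Reg910Cube T U η □ ξ dist C C₄ β₀`, `0 < η ≤ 1`, `0 < ξ`, `0 ≤ β ≤ β₀`, and a distance for which one lattice step has length in
`(0, η]` (`0 < dist z (T_κz) ≤ η`) ⟹ `Reg335LipCube T U η □° ξ C (C₄·(ξ∕η)^{1−β})` on the one-step interior `□° = {z ∈ □ | ∀ κ, z + e_κ ∈ □}` (the Hölder member at the pair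
`(z, z+e_κ′)` is the per-step letter of n15-c∕360 §4; the interior because (9)'s pairs live inside □ while r06-style derivative clauses are read at every site of the set).  Hence the whole
(PC-E) chain (n15-c∕361–364, 366) runs on the PRINTED per-cube class of [B11] Thm 1: at `β = β₀ = 1` (printed endpoint) with the `η`-free `C₁ = C₄`, at `β < 1` (the series' proofs,
cell GAPS C-B8-18) with `C₁ = C₄(ξ∕η)^{1−β}` and the rate of n15-c∕363 (`o_B^{expl}` linear in `C₁`, `O(L^{r(1−β)}L^{−kβ})`).  ★ `reg335LipCube_interior_of_reg910Cube_top` — the same at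
`β = β₀`.

HONEST FRAMING ∕ LIMITS.  A one-screen bridge between two typed DATA (hypotheses); the production of `Reg910Cube` data for the minimal configurations is [B11] Thm 1 itself (node N04∕N07
business; `B11Reg910Classes` types its STATEMENT), not claimed here.  Nothing of [B9]∕[B11] asserted.  NE2⁺ NOT PRINTED ∕ NOT proved; N15 of record untouched; K3⁸ OPEN; counts of
record UNMOVED (typed 28∕28 · discharged 8∕27); one finite 𝕋⁴ at fixed ε per index — NOT infinite volume, NOT OS on ℝ⁴, NOT a mass gap, NOT Clay.  Restate-immune (no Theses import).
-/

set_option autoImplicit false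

noncomputable section

namespace Summit.QuantumFields.YangMills.BalabanUVNodes.N15.CurvedSpecies

open Literature.MathematicalPhysics.QuantumFieldTheory.Balaban1983to89
open Literature.MathematicalPhysics.QuantumFieldTheory.Balaban1983to89.B9Eq39Adjoint (covD fluct)
open Literature.MathematicalPhysics.QuantumFieldTheory.Balaban1983to89.B9Eq3117Current (gaugeTr)
open Literature.MathematicalPhysics.QuantumFieldTheory.Balaban1983to89.B11Reg910Classes (Reg910Cube)

variable {𝔸 : Type*} [NormedRing 𝔸] [NormedAlgebra ℂ 𝔸] [CompleteSpace 𝔸] {S ι : Type*} [Fintype ι] [LinearOrder ι]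
  (T : ι → Equiv.Perm S) (U : ι → S → 𝔸ˣ)

/-- ★★★ **[B11] THM 1 (9)–(10) PER CUBE, AS TYPED (`Reg910Cube`) ⟹ `Reg335LipCube` ON THE ONE-STEP INTERIOR, `C₁ := C₄(ξ∕η)^{1−β}`** — for every admissible exponent
`0 ≤ β ≤ β₀`, with `0 < η ≤ 1`, `0 < ξ`, and one lattice step of length in `(0, η]` for the distance parameter of the Hölder member.
[cite: Balaban1985Variational, Thm 1 (9)–(10) p.279; Balaban1985BackgroundPropagators, (3.35) p.396, (3.40) p.397] -/
theorem reg335LipCube_interior_of_reg910Cube {η : ℝ} (hη : 0 < η) (hη1 : η ≤ 1) {cube : Set S} {ξ : ℝ} (hξ : 0 < ξ) {dist : S → S → ℝ} {C C₄ β₀ β : ℝ}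
    (hβ : 0 ≤ β) (hββ₀ : β ≤ β₀) (hdist : ∀ κ z, 0 < dist z (T κ z) ∧ dist z (T κ z) ≤ η) (h : Reg910Cube T U η cube ξ dist C C₄ β₀) :
    Reg335LipCube T U η {z | z ∈ cube ∧ ∀ κ, T κ z ∈ cube} ξ C (C₄ * (ξ / η) ^ (1 - β)) := by
  obtain ⟨u, A, hu, hg, hA, hD, hH, -, -⟩ := h
  refine reg335LipCube_of_holderStep T U hη hξ (fun z hz => hu z hz.1) (fun κ z hz => hg κ z hz.1) (fun κ z hz => hA κ z hz.1) (fun κ ν z hz => hD κ ν z hz.1)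
    (fun κ κ' ν z hz => ?_)
  have h1 := hH β hβ hββ₀ κ ν z hz.1 (T κ' z) (hz.2 κ') (hdist κ' z).1 ((hdist κ' z).2.trans hη1)
  refine h1.trans_le ?_
  have hC₄ : 0 ≤ C₄ := by
    -- `C₄ ≥ 0` is forced by the strict Hölder bound at the pair `(z, z + e_κ′)`
    by_contra hneg
    have h2 : C₄ * (ξ ^ (2 + β))⁻¹ * dist z (T κ' z) ^ β ≤ 0 :=
      mul_nonpos_of_nonpos_of_nonneg (mul_nonpos_of_nonpos_of_nonneg (le_of_lt (not_le.mp hneg)) (inv_nonneg.mpr (Real.rpow_nonneg hξ.le _)))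
        (Real.rpow_nonneg (hdist κ' z).1.le _)
    exact absurd (h1.trans_le h2) (not_lt.mpr (norm_nonneg _))
  rw [Real.rpow_neg hξ.le]
  exact mul_le_mul_of_nonneg_left (Real.rpow_le_rpow (hdist κ' z).1.le (hdist κ' z).2 hβ) (mul_nonneg hC₄ (inv_nonneg.mpr (Real.rpow_nonneg hξ.le _)))

/-- ★ The same at the top exponent `β = β₀` (`0 ≤ β₀`): `C₁ := C₄(ξ∕η)^{1−β₀}` — at the printed endpoint `β₀ = 1` this is the `η`-free `C₁ = C₄`.
[cite: Balaban1985Variational, Thm 1 (9) p.279 («0 ≤ β ≤ β₀ = 1»)] -/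
theorem reg335LipCube_interior_of_reg910Cube_top {η : ℝ} (hη : 0 < η) (hη1 : η ≤ 1) {cube : Set S} {ξ : ℝ} (hξ : 0 < ξ) {dist : S → S → ℝ} {C C₄ β₀ : ℝ}
    (hβ₀ : 0 ≤ β₀) (hdist : ∀ κ z, 0 < dist z (T κ z) ∧ dist z (T κ z) ≤ η) (h : Reg910Cube T U η cube ξ dist C C₄ β₀) :
    Reg335LipCube T U η {z | z ∈ cube ∧ ∀ κ, T κ z ∈ cube} ξ C (C₄ * (ξ / η) ^ (1 - β₀)) :=
  reg335LipCube_interior_of_reg910Cube T U hη hη1 hξ hβ₀ le_rfl hdist h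

/-- At the printed endpoint `β₀ = 1` the constant is `η`-free: `C₁ = C₄`. [cite: Balaban1985Variational, Thm 1 (9) p.279] -/
theorem reg335LipCube_interior_of_reg910Cube_one {η : ℝ} (hη : 0 < η) (hη1 : η ≤ 1) {cube : Set S} {ξ : ℝ} (hξ : 0 < ξ) {dist : S → S → ℝ} {C C₄ : ℝ}
    (hdist : ∀ κ z, 0 < dist z (T κ z) ∧ dist z (T κ z) ≤ η) (h : Reg910Cube T U η cube ξ dist C C₄ 1) :
    Reg335LipCube T U η {z | z ∈ cube ∧ ∀ κ, T κ z ∈ cube} ξ C C₄ := by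
  have h1 := reg335LipCube_interior_of_reg910Cube_top T U hη hη1 hξ zero_le_one hdist h
  rwa [sub_self, Real.rpow_zero, mul_one] at h1

end Summit.QuantumFields.YangMills.BalabanUVNodes.N15.CurvedSpecies

end
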